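import Summits.Ventures.LatticeQCDFlow.Scaling.SwapLadderRoundTripDEO

/-!
HONEST FRAMING: exact (Metropolis-corrected) sampling algorithms for lattice gauge theory; figures
of merit are autocorrelation/cost numbers at stated couplings and volumes; no continuum-physics
claim.

# SwapLadderRoundTripDEOIrreducible — THE LIFTED (DEO) INDEX WALK IS IRREDUCIBLE, SO ITS HITTING TIMES EXIST
# AND ARE UNIQUE: `SwapLadderRoundTripDEO`'s round-trip formula is not vacuous (row 22 `su3-ptbc`, GEN-5, ours)

Venture `LatticeQCDFlow` (cell pub-lqcd), topic `Scaling`; FANOUT row 22.  Elementary over `SwapLadderRoundTripDEO`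
(`deoWalk`, its entry lemmas, `deoWalk_isRowStochastic`) and the tree's Literature `RandomTargetLemma`
(`exists_isHittingTimeSolution`, `IsHittingTimeSolution.unique` for irreducible transition matrices) and
`SwapLadderDeliveryTime` (`pow_apply_nonneg_of_isRowStochastic`).  Nothing is cited as a fact.

* `deoNext` — the successor along the cycle `(0,↑) → (1,↑) → … → (K,↑) → (K,↓) → … → (0,↓) → (0,↑)`;
  `deoWalk_deoNext_pos` — each cycle step has positive probability (profile in `(0,1]`);
  `deoWalk_pow_iterate_pos` — hence `(P^n)(z, next^[n] z) > 0`;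
* `deoIdx` (position along the cycle), `deoIdx_deoNext`, `deoIdx_iterate`, `deoIdx_injective`,
  `exists_iterate_deoNext_eq` — the cycle visits every state from every state;
* **`deoWalk_isIrreducible`**, **`existsUnique_deo_hittingTime`**, and the non-vacuous round trip
  **`deo_round_trip'`**: THE hitting-time function of the lifted walk exists, and its round trip `⊥ → ⊤ → ⊥` is
  `2(K+1) + 2(K+1)·Σ_{i<K} (1 − a_i)/a_i`;
* **`deo_round_trip_lt_seo`** — for the same profile and `K ≥ 2` the DEO round trip is strictly shorter than the
  reversible walk's (`SwapLadderRoundTrip.profile_round_trip`), by `2(K+1)(K−1)` (Syed et al. 2022, Cor. 1).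
-/

noncomputable section

open Finset
open Literature.Probability.MarkovChains

namespace Summit.Ventures.LatticeQCDFlow.Scaling

variable {K : ℕ}

/-! ## The cycle -/

/-- The successor along the grand cycle of the lifted walk. [ours] -/
def deoNext (K : ℕ) : Fin (K + 1) × Bool → Fin (K + 1) × Bool
  | (i, true) => if h : i.val < K then (⟨i.val + 1, Nat.succ_lt_succ h⟩, true) else (i, false)
  | (i, false) => if 0 < i.val then (⟨i.val - 1, (Nat.sub_le i.val 1).trans_lt i.isLt⟩, false) else (i, true)

/-- Position along the cycle: `(i,↑) ↦ i`, `(i,↓) ↦ 2K + 1 − i`. [ours] -/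
def deoIdx (K : ℕ) : Fin (K + 1) × Bool → ℕ
  | (i, true) => i.val
  | (i, false) => 2 * K + 1 - i.val

/-- `deoNext` at an up-state. [ours] -/
theorem deoNext_up (i : Fin (K + 1)) :
    deoNext K (i, true) = if h : i.val < K then (⟨i.val + 1, Nat.succ_lt_succ h⟩, true) else (i, false) := rfl

/-- `deoNext` at a down-state. [ours] -/
theorem deoNext_down (i : Fin (K + 1)) :
    deoNext K (i, false)
      = if 0 < i.val then (⟨i.val - 1, (Nat.sub_le i.val 1).trans_lt i.isLt⟩, false) else (i, true) := rfl

/-- `deoIdx (i,↑) = i`. [ours] -/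
theorem deoIdx_up (i : Fin (K + 1)) : deoIdx K (i, true) = i.val := rfl

/-- `deoIdx (i,↓) = 2K + 1 − i`. [ours] -/
theorem deoIdx_down (i : Fin (K + 1)) : deoIdx K (i, false) = 2 * K + 1 - i.val := rfl

/-- Positions are `< 2K + 2`. [ours] -/
theorem deoIdx_lt (z : Fin (K + 1) × Bool) : deoIdx K z < 2 * K + 2 := by
  obtain ⟨i, b⟩ := z
  have := i.isLt
  cases b
  · rw [deoIdx_down]; omega
  · rw [deoIdx_up]; omega

/-- `deoIdx` is injective. [ours] -/
theorem deoIdx_injective : Function.Injective (deoIdx K) := by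
  rintro ⟨i, b⟩ ⟨j, c⟩ h
  have hi := i.isLt
  have hj := j.isLt
  cases b <;> cases c
  · rw [deoIdx_down, deoIdx_down] at h
    have hij : i = j := Fin.ext (by omega)
    rw [hij]
  · rw [deoIdx_down, deoIdx_up] at h
    exfalso; omega
  · rw [deoIdx_up, deoIdx_down] at h
    exfalso; omega
  · rw [deoIdx_up, deoIdx_up] at h
    have hij : i = j := Fin.ext h
    rw [hij]

/-- One cycle step advances the position by one, modulo the cycle length `2K + 2`. [ours] -/
theorem deoIdx_deoNext (z : Fin (K + 1) × Bool) : deoIdx K (deoNext K z) = (deoIdx K z + 1) % (2 * K + 2) := by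
  obtain ⟨i, b⟩ := z
  have hi := i.isLt
  cases b
  · by_cases h0 : 0 < i.val
    · rw [deoNext_down, if_pos h0, deoIdx_down, deoIdx_down]
      simp only
      rw [Nat.mod_eq_of_lt (by omega)]
      omega
    · rw [deoNext_down, if_neg h0, deoIdx_up, deoIdx_down]
      have e : i.val = 0 := by omega
      rw [e, Nat.sub_zero, show 2 * K + 1 + 1 = 2 * K + 2 by ring, Nat.mod_self]
  · by_cases hK : i.val < K
    · rw [deoNext_up, dif_pos hK, deoIdx_up, deoIdx_up]
      simp only
      rw [Nat.mod_eq_of_lt (by omega)]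
    · rw [deoNext_up, dif_neg hK, deoIdx_down, deoIdx_up]
      rw [Nat.mod_eq_of_lt (by omega)]
      omega

/-- `n` cycle steps advance the position by `n` modulo `2K + 2`. [ours] -/
theorem deoIdx_iterate (n : ℕ) (z : Fin (K + 1) × Bool) :
    deoIdx K ((deoNext K)^[n] z) = (deoIdx K z + n) % (2 * K + 2) := by
  induction n with
  | zero => rw [Function.iterate_zero, id, add_zero, Nat.mod_eq_of_lt (deoIdx_lt z)]
  | succ n ih =>
    rw [Function.iterate_succ_apply', deoIdx_deoNext, ih, Nat.mod_add_mod, add_assoc]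

/-- **The cycle visits every state from every state.** [ours] -/
theorem exists_iterate_deoNext_eq (x y : Fin (K + 1) × Bool) : ∃ n : ℕ, (deoNext K)^[n] x = y := by
  refine ⟨2 * K + 2 - deoIdx K x + deoIdx K y, deoIdx_injective ?_⟩
  rw [deoIdx_iterate]
  have hx := deoIdx_lt x
  have hy := deoIdx_lt y
  have e : deoIdx K x + (2 * K + 2 - deoIdx K x + deoIdx K y) = deoIdx K y + (2 * K + 2) := by omega
  rw [e, Nat.add_mod_right, Nat.mod_eq_of_lt hy]

/-! ## Positivity along the cycle and irreducibility -/

variable {a : ℕ → ℝ}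

/-- **Each cycle step has positive probability** (profile in `(0, 1]`). [ours] -/
theorem deoWalk_deoNext_pos (ha0 : ∀ j, 0 < a j) (z : Fin (K + 1) × Bool) : 0 < deoWalk K a z (deoNext K z) := by
  obtain ⟨i, b⟩ := z
  have hi := i.isLt
  cases b
  · by_cases h0 : 0 < i.val
    · rw [deoNext_down, if_pos h0, deoWalk_down_down, if_pos (by simp only; omega)]
      exact ha0 _
    · rw [deoNext_down, if_neg h0, deoWalk_down_up, if_pos rfl, if_pos (by omega)]
      exact one_pos
  · by_cases hK : i.val < K
    · rw [deoNext_up, dif_pos hK, deoWalk_up_up, if_pos rfl]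
      exact ha0 _
    · rw [deoNext_up, dif_neg hK, deoWalk_up_down, if_pos rfl, if_neg hK]
      exact one_pos

/-- `(P^n)(z, next^[n] z) > 0` for a transition matrix `P = deoWalk K a` with positive profile. [ours] -/
theorem deoWalk_pow_iterate_pos (ha0 : ∀ j, 0 < a j) (ha1 : ∀ j, a j ≤ 1) :
    ∀ (n : ℕ) (z : Fin (K + 1) × Bool), 0 < (deoWalk K a ^ n) z ((deoNext K)^[n] z)
  | 0, z => by rw [pow_zero, Function.iterate_zero, id, Matrix.one_apply_eq]; exact one_pos
  | n + 1, z => by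
    have hP := deoWalk_isRowStochastic (K := K) a (fun j => (ha0 j).le) ha1
    rw [pow_succ', Matrix.mul_apply, Function.iterate_succ_apply]
    have hstep := deoWalk_deoNext_pos ha0 z (K := K)
    have ih := deoWalk_pow_iterate_pos ha0 ha1 n (deoNext K z)
    calc (0 : ℝ) < deoWalk K a z (deoNext K z) * (deoWalk K a ^ n) (deoNext K z) ((deoNext K)^[n] (deoNext K z)) :=
          mul_pos hstep ih
      _ ≤ ∑ w, deoWalk K a z w * (deoWalk K a ^ n) w ((deoNext K)^[n] (deoNext K z)) :=
          single_le_sum (f := fun w => deoWalk K a z w * (deoWalk K a ^ n) w ((deoNext K)^[n] (deoNext K z)))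
            (fun w _ => mul_nonneg (hP.1 z w) (pow_apply_nonneg_of_isRowStochastic hP n w _)) (mem_univ _)

/-- **THE LIFTED WALK IS IRREDUCIBLE** (profile in `(0, 1]`). [ours] -/
theorem deoWalk_isIrreducible (ha0 : ∀ j, 0 < a j) (ha1 : ∀ j, a j ≤ 1) : IsIrreducible (deoWalk K a) := by
  intro x y
  obtain ⟨n, hn⟩ := exists_iterate_deoNext_eq x y
  exact ⟨n, hn ▸ deoWalk_pow_iterate_pos ha0 ha1 n x⟩

/-- **Hitting times of the lifted walk exist and are unique.** [ours] -/
theorem existsUnique_deo_hittingTime (ha0 : ∀ j, 0 < a j) (ha1 : ∀ j, a j ≤ 1) :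
    ∃! h : Fin (K + 1) × Bool → Fin (K + 1) × Bool → ℝ, IsHittingTimeSolution (deoWalk K a) h := by
  have hP := deoWalk_isRowStochastic (K := K) a (fun j => (ha0 j).le) ha1
  have hirr := deoWalk_isIrreducible ha0 ha1 (K := K)
  obtain ⟨h, hh⟩ := exists_isHittingTimeSolution hP hirr
  exact ⟨h, hh, fun h' hh' => IsHittingTimeSolution.unique hP hirr hh' hh⟩

/-- **THE DEO ROUND TRIP, non-vacuous form**: THE hitting-time function of the lifted walk exists and its
round trip `⊥ → ⊤ → ⊥` is `2(K+1) + 2(K+1)·Σ_{i<K} (1 − a_i)/a_i` (profile in `(0,1]`). [ours] -/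
theorem deo_round_trip' (ha0 : ∀ j, 0 < a j) (ha1 : ∀ j, a j ≤ 1) :
    ∃ h : Fin (K + 1) × Bool → Fin (K + 1) × Bool → ℝ, IsHittingTimeSolution (deoWalk K a) h ∧
      h (deoBot K) (deoTop K) + h (deoTop K) (deoBot K)
        = 2 * ((K : ℝ) + 1) + 2 * ((K : ℝ) + 1) * ∑ i ∈ range K, (1 - a i) / a i := by
  obtain ⟨h, hh, -⟩ := existsUnique_deo_hittingTime ha0 ha1 (K := K)
  exact ⟨h, hh, deo_round_trip hh fun j => (ha0 j).ne'⟩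

/-- **NON-REVERSIBLE BEATS REVERSIBLE (Syed et al. 2022, Cor. 1): for the same acceptance profile in `(0,1]`
and `K ≥ 2` intervals, the DEO round trip is STRICTLY shorter than the reversible walk's** — by exactly
`2(K+1)(K−1)` scans (`SwapLadderRoundTripDEO.deo_round_trip_eq_seo_sub`, `SwapLadderRoundTrip.profile_round_trip`),
for every pair of hitting-time solutions `h` (DEO) and `g` (SEO). [ours] -/
theorem deo_round_trip_lt_seo (hK : 2 ≤ K) (ha0 : ∀ j, 0 < a j) (ha1 : ∀ j, a j ≤ 1)
    {h : Fin (K + 1) × Bool → Fin (K + 1) × Bool → ℝ} (hh : IsHittingTimeSolution (deoWalk K a) h)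
    {g : Fin (K + 1) → Fin (K + 1) → ℝ} (hg : IsHittingTimeSolution (profileWalk K a) g) :
    h (deoBot K) (deoTop K) + h (deoTop K) (deoBot K) < g 0 (Fin.last K) + g (Fin.last K) 0 := by
  rw [deo_round_trip_eq_seo_sub hh (fun j => (ha0 j).ne'), profile_round_trip ha0 ha1 hg]
  have hK' : (2 : ℝ) ≤ K := by exact_mod_cast hK
  nlinarith

end Summit.Ventures.LatticeQCDFlow.Scaling

end
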